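import Mathlib.Analysis.Calculus.ContDiff.Basic
import Mathlib.Analysis.Calculus.FDeriv.Basic
import Mathlib.Analysis.InnerProductSpace.Calculus
import Mathlib.Topology.Order.LocalExtr
import Mathlib.Geometry.Manifold.MFDeriv.Basic
import Mathlib.Geometry.Manifold.Instances.Sphere
import Literature.Topology.FourManifolds.Knots
import Literature.Topology.FourManifolds.LocallyFlat
import HarnessLib

-- provenance: harness21/H21/H21/Prelude/FourManM/SliceRibbon.lean @ d549e1a (interim HEAD d8f2665); M5 mechanical rewrite
/-!
# Slice knots, ribbon knots and knot concordance (trunk T-4MAN, outline C13)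

This prelude file of the H21 library (trunk `FourManM`; notions `slice_ribbon_concordance`,
`locally_flat_embedding`) defines, for classical knots `K : 𝕊 1 → 𝕊 3` (`Literature.Topology.FourManifolds.Knot`):

* `Literature.Knot.IsSliceDisc K f`: `f : ℝ² → ℝ⁴` restricts on the closed unit disc `𝔻²` to a
  smooth, properly and *neatly* embedded disc in the unit ball `B⁴` with boundary `K`;
  `Literature.Knot.IsSmoothlySlice K`: `K` bounds such a disc (Fox 1962);
* `Literature.Knot.IsRibbonDisc K f`, `Literature.Knot.IsRibbon K`: the slice disc has no local maxima of
  the radius function (Gompf–Stipsicz 1999, §6.2);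
* `Literature.Knot.IsTopologicallySlice K`: `K` bounds a flat (= product-neighbourhood) topological
  disc in `B⁴` (Freedman–Quinn 1990, §9.3), with the bridge
  `Literature.Topology.FourManifolds.Knot.IsTopologicallySlice.exists_isLocallyFlat` to `Literature.Topology.FourManifolds.IsLocallyFlat`;
* `Literature.Knot.IsConcordance K K' f`, `Literature.Knot.IsConcordant K K'`, `Literature.Topology.FourManifolds.ConcordanceClass`:
  smooth concordance of knots (Fox–Milnor 1966) and the set of concordance classes.

## Sources

* R. H. Fox, *A quick trip through knot theory* (1962), §7 (slice knots), Problem 25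
  (slice–ribbon).
* R. H. Fox, J. W. Milnor, *Singularities of 2-spheres in 4-space and cobordism of knots*,
  Osaka J. Math. 3 (1966) (concordance group).
* M. Freedman, F. Quinn, *Topology of 4-manifolds* (1990), §9.3 (flat embeddings), §11.7.
* R. Gompf, A. Stipsicz, *4-manifolds and Kirby calculus* (1999), §6.2 (ribbon discs = slice
  discs on which the radial function has no local maxima); R. Kirby, *Problems in
  low-dimensional topology* (1997), Problem 1.33.
* C. Livingston, *A survey of classical knot concordance*, Handbook of knot theory (2005), §2.
* Mathlib: `ContDiff`, `fderiv`, `iteratedFDeriv`, `IsLocalMax`, `mfderiv`, `Metric.sphere`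
  and its manifold structure. Mathlib (v4.32.0) has no slice/ribbon knots or knot concordance
  (searched `Slice`, `Ribbon`, `Concordan`).

## Design choices

* Everything happens in `ℝ⁴ ⊃ 𝕊 3 = ∂B⁴` and `ℝ² ⊃ 𝕊 1 = ∂𝔻²`.  Surfaces with boundary
  (discs, annuli) are given by smooth maps **on the ambient Euclidean space / on `𝕊 1 × ℝ`**
  and only their restriction to the closed disc `𝔻²` / the annulus `𝕊 1 × [1, 2]` matters;
  by Seeley's extension theorem this is equivalent to working with compact smooth surfaces
  with boundary properly embedded in `B⁴` resp. `S³ × [1, 2]`, and avoids manifolds with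
  boundary/corners.
* Slice discs are required to be **neat** (transverse to `𝕊 3` along `K`): the radial
  derivative of `ρ_f := ‖f‖ ^ 2` is positive along `∂𝔻²`.  Every smooth slice disc is isotopic
  to a neat one (straighten a collar), so `IsSmoothlySlice` is the usual notion; neatness makes
  the Morse-theoretic ribbon condition below literally the one of Gompf–Stipsicz (critical
  points of `ρ_f` cannot accumulate at the boundary).
* `IsRibbonDisc` is the *embedded* characterisation of ribbon discs: a slice disc on which
  `ρ_f` is Morse without interior local maxima.  Its equivalence with the classical definition
  (`K` bounds an immersed disc in `S³` with only ribbon singularities) is Gompf–Stipsicz (1999),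
  §6.2 / Kirby Problem 1.33; it is cited, not stated.
* `IsTopologicallySlice` uses the product-neighbourhood formulation of flatness (an embedding
  of `𝔻² × ℝ²`), which is the form used by Freedman–Quinn; the interior of the core disc is then
  locally flat in the sense of `Literature.IsLocallyFlat 2 4` (`exists_isLocallyFlat`, a named fact).
* Unproved results are vendored as named facts `def foo : Prop := …` (D-0014) and threaded as
  explicit hypotheses through their in-file consumers; the unknot needs the Knots-prelude fact
  bundle `[SphereEmbedding.SmoothnessFacts]`, symmetry of isotopy `[SphereEmbedding.IsotopyFacts 1 3]`.
* Concordances are smooth neat annuli in the shell `{1 ≤ ‖y‖ ≤ 2} ≅ S³ × [1, 2]` from `K` (on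
  the unit sphere) to `2 • K'` (on the sphere of radius `2`).
* Deferred (not in this file): the slice genus `g₄`, connected sum of knots and the group law
  on `ConcordanceClass` (Fox–Milnor 1966).
* Notation `𝔼 n`, `𝕊 n` is local, exactly as in the SPC4 statement files; `𝔻²` is local
  notation for `Metric.closedBall (0 : 𝔼 2) 1`.
-/

open scoped Manifold ContDiff Topology
open Function Set

noncomputable section

namespace Literature.Topology.FourManifolds

/-- Local notation: `𝔼 n` is the model Euclidean space `EuclideanSpace ℝ (Fin n)`. -/
local notation "𝔼 " n:arg => EuclideanSpace ℝ (Fin n)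

/-- Local notation: `𝕊 n` is the unit sphere in `EuclideanSpace ℝ (Fin (n + 1))`. -/
local notation "𝕊 " n:arg => (Metric.sphere (0 : EuclideanSpace ℝ (Fin (n + 1))) 1)

/-- Local notation: `𝔻²` is the closed unit disc in `ℝ²`. -/
local notation "𝔻²" => Metric.closedBall (0 : EuclideanSpace ℝ (Fin 2)) 1

namespace Knot

/-! ## Smooth slice discs and ribbon discs -/

/-- `f : ℝ² → ℝ⁴` is a **slice disc** for the knot `K`: `f` is `C^∞`, an injective immersion
on the closed unit disc `𝔻²`, maps the open disc into the open unit ball `B⁴`, is **neat**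
along the boundary (the radial derivative of `ρ_f := ‖f‖ ^ 2` at `x ∈ ∂𝔻²` in the direction
`x` is positive, i.e. the disc meets `𝕊 3` transversally), and restricts to `K` on
`𝕊 1 = ∂𝔻²`.  Every smooth slice disc is isotopic to a neat one by a collar argument.
Fox (1962), §7; Gompf–Stipsicz (1999), §6.2; Livingston (2005), §2. [cite: Fox1962] -/
def IsSliceDisc (K : Knot) (f : 𝔼 2 → 𝔼 4) : Prop :=
  ContDiff ℝ ∞ f ∧ InjOn f 𝔻² ∧
    (∀ x ∈ 𝔻², Injective (fderiv ℝ f x)) ∧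
    (∀ x : 𝔼 2, ‖x‖ < 1 → ‖f x‖ < 1) ∧
    (∀ x : 𝔼 2, ‖x‖ = 1 → 0 < fderiv ℝ (fun y ↦ ‖f y‖ ^ 2) x x) ∧
    ∀ x : 𝕊 1, f x = K x

/-- A knot is **smoothly slice** if it bounds a smooth slice disc in `B⁴`.
Fox (1962), §7; Livingston (2005), §2. [cite: Fox1962] -/
def IsSmoothlySlice (K : Knot) : Prop :=
  ∃ f, K.IsSliceDisc f

/-- `f` is a **ribbon disc** for `K`: a slice disc on which the radius-squared function
`ρ_f := ‖f‖ ^ 2` is Morse without local maxima on the open disc, i.e. every interior critical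
point of `ρ_f` has nondegenerate Hessian and is not a local maximum.  By Gompf–Stipsicz (1999),
§6.2 (cf. Kirby, Problem 1.33) a knot bounds such a disc iff it bounds an immersed disc in
`S³` with only ribbon singularities (the classical definition of Fox 1962); we take the
4-dimensional characterisation as the definition. [cite: Fox1962] -/
def IsRibbonDisc (K : Knot) (f : 𝔼 2 → 𝔼 4) : Prop :=
  K.IsSliceDisc f ∧
    let ρ : 𝔼 2 → ℝ := fun x ↦ ‖f x‖ ^ 2
    ∀ x : 𝔼 2, ‖x‖ < 1 → fderiv ℝ ρ x = 0 →
      (∀ v : 𝔼 2, v ≠ 0 → ∃ w : 𝔼 2, iteratedFDeriv ℝ 2 ρ x ![v, w] ≠ 0) ∧ ¬ IsLocalMax ρ x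

/-- A knot is **ribbon** if it bounds a ribbon disc. Fox (1962), Problem 25;
Gompf–Stipsicz (1999), §6.2. [cite: Fox1962] -/
def IsRibbon (K : Knot) : Prop :=
  ∃ f, K.IsRibbonDisc f

/-- A ribbon disc is a slice disc (by definition). [folklore] -/
theorem IsRibbonDisc.isSliceDisc {K : Knot} {f : 𝔼 2 → 𝔼 4} (h : K.IsRibbonDisc f) :
    K.IsSliceDisc f :=
  h.1

/-- Ribbon knots are smoothly slice (the converse is the slice–ribbon conjecture, Fox 1962,
Problem 25). [cite: Fox1962, Problem 25] -/
theorem IsRibbon.isSmoothlySlice {K : Knot} (h : K.IsRibbon) : K.IsSmoothlySlice := by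
  obtain ⟨f, hf⟩ := h
  exact ⟨f, hf.isSliceDisc⟩

/-! ## Topologically slice knots -/

/-- A knot is **topologically slice** if it bounds a *flat* topological disc in `B⁴`: there is
a map `F : ℝ² × ℝ² → ℝ⁴` which is a topological embedding on `𝔻² × ℝ²` (a product
neighbourhood of the core disc `F (·, 0)`), maps `𝔻² × ℝ²` into the closed ball meeting `𝕊 3`
exactly along `∂𝔻² × ℝ²`, and whose core restricts to `K` on `𝕊 1`.
Freedman–Quinn (1990), §9.3; Livingston (2005), §2. [cite: FreedmanQuinn1990] -/
def IsTopologicallySlice (K : Knot) : Prop :=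
  ∃ F : 𝔼 2 × 𝔼 2 → 𝔼 4,
    Topology.IsEmbedding ((𝔻² ×ˢ univ).restrict F) ∧
    (∀ x w, ‖x‖ ≤ 1 → ‖F (x, w)‖ ≤ 1 ∧ (‖F (x, w)‖ = 1 ↔ ‖x‖ = 1)) ∧
    ∀ x : 𝕊 1, F (x, 0) = K x

/-- The core of a flat disc maps the open unit disc into the open unit ball. [folklore] -/
theorem IsTopologicallySlice.mapsTo {F : 𝔼 2 × 𝔼 2 → 𝔼 4}
    (hF : ∀ x w, ‖x‖ ≤ 1 → ‖F (x, w)‖ ≤ 1 ∧ (‖F (x, w)‖ = 1 ↔ ‖x‖ = 1)) :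
    MapsTo (fun x ↦ F (x, 0)) (Metric.ball (0 : 𝔼 2) 1) (Metric.ball (0 : 𝔼 4) 1) := by
  intro x hx
  rw [mem_ball_zero_iff] at hx ⊢
  obtain ⟨hle, hiff⟩ := hF x 0 hx.le
  exact lt_of_le_of_ne hle fun h ↦ hx.ne (hiff.mp h)

/-- **Bridge to `IsLocallyFlat`.** A topologically slice knot bounds a flat disc whose
interior, as a map from the open disc `ball 0 1 ⊆ ℝ²` to the open ball `ball 0 1 ⊆ ℝ⁴`, is a
locally flat embedding in the sense of `Literature.IsLocallyFlat 2 4`: the product neighbourhood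
`F (x, ·)` provides the local pair charts `(ℝ⁴, ℝ²)` at interior points.
Freedman–Quinn (1990), §9.3; Daverman–Venema (2009), §1.1. Vendored as a named fact (D-0014). [cite: FreedmanQuinn1990] -/
def IsTopologicallySlice.exists_isLocallyFlat : Prop :=
  ∀ {K : Knot}, K.IsTopologicallySlice →
    ∃ F : 𝔼 2 × 𝔼 2 → 𝔼 4, ∃ hF : Topology.IsEmbedding ((𝔻² ×ˢ univ).restrict F) ∧
      (∀ x w, ‖x‖ ≤ 1 → ‖F (x, w)‖ ≤ 1 ∧ (‖F (x, w)‖ = 1 ↔ ‖x‖ = 1)) ∧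
      ∀ x : 𝕊 1, F (x, 0) = K x,
      IsLocallyFlat 2 4 (IsTopologicallySlice.mapsTo hF.2.1).restrict

/-- Smoothly slice knots are topologically slice: a tubular neighbourhood of a smooth neat
slice disc is a product neighbourhood. Freedman–Quinn (1990), §9.3; Livingston (2005), §2.
Vendored as a named fact (D-0014). [cite: FreedmanQuinn1990] -/
def IsSmoothlySlice.isTopologicallySlice : Prop :=
  ∀ {K : Knot}, K.IsSmoothlySlice → K.IsTopologicallySlice

/-! ## Concordance -/

/-- `f : 𝕊 1 × ℝ → ℝ⁴` is a **concordance** from `K` to `K'`: `f` is `C^∞`, an injective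
immersion on the annulus `𝕊 1 × [1, 2]`, maps `𝕊 1 × (1, 2)` into the open shell
`{1 < ‖y‖ < 2}`, is neat at both ends (the `t`-derivative of `‖f (x, t)‖ ^ 2` is positive at
`t = 1` and `t = 2`, i.e. the annulus is transverse to both boundary spheres), and restricts to
`K` on `𝕊 1 × {1}` and to `2 • K'` on `𝕊 1 × {2}`.  Identifying the shell with `S³ × [1, 2]`
radially, this is a smooth properly embedded annulus `S¹ × I ↪ S³ × I` between `K` and `K'`.
Fox–Milnor (1966); Livingston (2005), §2.1. [cite: FoxMilnor1966] -/
def IsConcordance (K K' : Knot) (f : (𝕊 1) × ℝ → 𝔼 4) : Prop :=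
  ContMDiff ((𝓡 1).prod 𝓘(ℝ, ℝ)) 𝓘(ℝ, 𝔼 4) ∞ f ∧
    InjOn f (univ ×ˢ Icc 1 2) ∧
    (∀ p ∈ univ ×ˢ Icc (1 : ℝ) 2,
      Injective (mfderiv ((𝓡 1).prod 𝓘(ℝ, ℝ)) 𝓘(ℝ, 𝔼 4) f p)) ∧
    (∀ x t, t ∈ Ioo (1 : ℝ) 2 → 1 < ‖f (x, t)‖ ∧ ‖f (x, t)‖ < 2) ∧
    (∀ x, 0 < deriv (fun t ↦ ‖f (x, t)‖ ^ 2) 1 ∧ 0 < deriv (fun t ↦ ‖f (x, t)‖ ^ 2) 2) ∧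
    (∀ x, f (x, 1) = K x) ∧
    ∀ x, f (x, 2) = (2 : ℝ) • (K' x : 𝔼 4)

/-- Two knots are (smoothly) **concordant** if there is a concordance between them.
Fox–Milnor (1966); Livingston (2005), §2.1. [cite: FoxMilnor1966] -/
def IsConcordant (K K' : Knot) : Prop :=
  ∃ f, IsConcordance K K' f

/-- Concordance is an equivalence relation on knots (reflexivity: the radial product annulus
`(x, t) ↦ t • K x`; symmetry: the orientation-reversing diffeomorphism
`(u, t) ↦ (u, 3 - t)` of the shell `S³ × [1, 2]`; transitivity: stack and rescale two annuli,
smoothing along the common knot using neatness).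
Fox–Milnor (1966), §1; Livingston (2005), Thm. 2.1. Vendored as a named fact (D-0014). [cite: FoxMilnor1966] -/
def _root_.Literature.Topology.FourManifolds.equivalence_isConcordant : Prop :=
  Equivalence IsConcordant

/-- Concordance is reflexive (from the named fact `equivalence_isConcordant`).
Fox–Milnor (1966). [cite: FoxMilnor1966] -/
theorem IsConcordant.refl (hE : equivalence_isConcordant) (K : Knot) : K.IsConcordant K :=
  Equivalence.refl hE K

/-- Concordance is symmetric (from the named fact `equivalence_isConcordant`).
Fox–Milnor (1966). [cite: FoxMilnor1966] -/
theorem IsConcordant.symm (hE : equivalence_isConcordant) {K K' : Knot} (h : K.IsConcordant K') :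
    K'.IsConcordant K :=
  Equivalence.symm hE h

/-- Concordance is transitive (from the named fact `equivalence_isConcordant`).
Fox–Milnor (1966). [cite: FoxMilnor1966] -/
theorem IsConcordant.trans (hE : equivalence_isConcordant) {K K' K'' : Knot}
    (h : K.IsConcordant K') (h' : K'.IsConcordant K'') : K.IsConcordant K'' :=
  Equivalence.trans hE h h'

/-- A knot is smoothly slice iff it is concordant to the unknot (cap off the unknot end of a
concordance with the flat disc, resp. remove a small flat disc from a slice disc).
Fox–Milnor (1966), §1; Livingston (2005), §2.1. Vendored as a named fact (D-0014). [cite: FoxMilnor1966] -/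
def isSmoothlySlice_iff_isConcordant_unknot : Prop :=
  ∀ [SphereEmbedding.SmoothnessFacts] {K : Knot}, K.IsSmoothlySlice ↔ K.IsConcordant unknot

/-- Isotopic knots are concordant (the trace `(x, t) ↦ t • F t (K x)` of an ambient isotopy,
reparametrised to be stationary near the ends, is a concordance). Livingston (2005), §2.1.
Vendored as a named fact (D-0014). [cite: Livingston2005] -/
def IsConcordant.of_isIsotopic : Prop :=
  ∀ {K K' : Knot}, K.IsIsotopic K' → K.IsConcordant K'

/-! ## Invariance under isotopy -/

/-- Smooth sliceness is an invariant of the knot type: an ambient isotopy of `𝕊 3` extends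
radially (damped near the origin) to a diffeomorphism of `B⁴` carrying slice discs to slice
discs. Livingston (2005), §2. Vendored as a named fact (D-0014). [cite: Livingston2005] -/
def IsSmoothlySlice.of_isIsotopic : Prop :=
  ∀ {K K' : Knot}, K.IsIsotopic K' → K.IsSmoothlySlice → K'.IsSmoothlySlice

/-- Being ribbon is an invariant of the knot type (attach the trace of the isotopy in a collar;
this adds no critical points of the radial function). Gompf–Stipsicz (1999), §6.2. Vendored as a
named fact (D-0014). [cite: GompfStipsicz1999] -/
def IsRibbon.of_isIsotopic : Prop :=
  ∀ {K K' : Knot}, K.IsIsotopic K' → K.IsRibbon → K'.IsRibbon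

/-- Topological sliceness is an invariant of the knot type. Freedman–Quinn (1990), §9.3;
Livingston (2005), §2. Vendored as a named fact (D-0014). [cite: FreedmanQuinn1990] -/
def IsTopologicallySlice.of_isIsotopic : Prop :=
  ∀ {K K' : Knot}, K.IsIsotopic K' → K.IsTopologicallySlice → K'.IsTopologicallySlice

end Knot

/-! ## Concordance classes -/

/-- The set of (smooth) **concordance classes** of knots, `Knot / IsConcordant`.  With connected
sum this is the classical knot concordance group `𝒞` of Fox–Milnor (1966) (group law deferred).
Livingston (2005), §2.1. [cite: FoxMilnor1966] -/
def ConcordanceClass : Type :=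
  Quot Knot.IsConcordant

/-- The concordance class of a knot. Fox–Milnor (1966). [cite: FoxMilnor1966] -/
def ConcordanceClass.mk (K : Knot) : ConcordanceClass :=
  Quot.mk _ K

/-- Two knots have the same concordance class iff they are concordant (given the named fact
`equivalence_isConcordant`). [folklore] -/
theorem ConcordanceClass.mk_eq_mk_iff (hE : equivalence_isConcordant) {K K' : Knot} :
    ConcordanceClass.mk K = ConcordanceClass.mk K' ↔ K.IsConcordant K' :=
  ⟨fun h ↦ (Equivalence.eqvGen_iff hE).mp (Quot.eqvGen_exact h),
    fun h ↦ Quot.sound h⟩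

/-- Every concordance class is the class of a knot. [folklore] -/
theorem ConcordanceClass.mk_surjective : Surjective ConcordanceClass.mk :=
  Quot.mk_surjective

/-- Isotopic knots have the same concordance class: `ConcordanceClass.mk` factors through
`KnotClass` (given the named fact `Knot.IsConcordant.of_isIsotopic`). Livingston (2005), §2.1. [cite: Livingston2005] -/
theorem ConcordanceClass.mk_eq_mk_of_isIsotopic (hI : Knot.IsConcordant.of_isIsotopic)
    {K K' : Knot} (h : K.IsIsotopic K') :
    ConcordanceClass.mk K = ConcordanceClass.mk K' :=
  Quot.sound (hI h)

/-! ## The unknot is ribbon -/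

/-- The **flat disc** `ℝ² → ℝ⁴`, `x ↦ (x₀, x₁, 0, 0)` (the zero padding
`Literature.euclideanInclusion 2 4` bundled as a continuous linear map): the standard slice (indeed
ribbon) disc for the unknot. Standard; Gompf–Stipsicz (1999), §6.2. [cite: GompfStipsicz1999] -/
def flatDisc : 𝔼 2 →L[ℝ] 𝔼 4 :=
  LinearMap.toContinuousLinearMap
    { toFun := euclideanInclusion 2 4
      map_add' := fun x y ↦ by
        ext i
        simp only [euclideanInclusion_apply, PiLp.add_apply]
        split_ifs <;> simp
      map_smul' := fun c x ↦ by
        ext i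
        simp only [euclideanInclusion_apply, PiLp.smul_apply, RingHom.id_apply, smul_eq_mul]
        split_ifs <;> simp }

/-- The flat disc is the zero padding `ℝ² → ℝ⁴` (`Literature.euclideanInclusion 2 4`). [folklore] -/
theorem flatDisc_apply (x : 𝔼 2) : flatDisc x = euclideanInclusion 2 4 x := rfl

/-- The flat disc preserves norms. [folklore] -/
@[simp]
theorem norm_flatDisc (x : 𝔼 2) : ‖flatDisc x‖ = ‖x‖ :=
  norm_euclideanInclusion (by norm_num) x

/-- The flat disc is injective. [folklore] -/
theorem flatDisc_injective : Injective flatDisc := by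
  intro x y h
  rw [← sub_eq_zero, ← norm_eq_zero, ← norm_flatDisc, map_sub, h, sub_self, norm_zero]

/-- On the boundary circle the flat disc is the unknot `(x₀, x₁) ↦ (x₀, x₁, 0, 0)`. [folklore] -/
@[simp]
theorem flatDisc_coe_sphere [SphereEmbedding.SmoothnessFacts] (x : 𝕊 1) :
    flatDisc x = unknot x := rfl

/-- The flat disc is a (neat) slice disc for the unknot: its radius-squared function is
`‖x‖ ^ 2`, with radial derivative `2` along the unit circle. Gompf–Stipsicz (1999), §6.2. [cite: GompfStipsicz1999] -/
theorem isSliceDisc_unknot_flatDisc [SphereEmbedding.SmoothnessFacts] :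
    unknot.IsSliceDisc flatDisc := by
  refine ⟨flatDisc.contDiff, flatDisc_injective.injOn, fun x _ ↦ ?_, fun x hx ↦ ?_,
    fun x hx ↦ ?_, fun x ↦ rfl⟩
  · rw [ContinuousLinearMap.fderiv]
    exact flatDisc_injective
  · rwa [norm_flatDisc]
  · simp_rw [norm_flatDisc]
    rw [fderiv_norm_sq_apply]
    simp [hx]

/-- The flat disc is a ribbon disc for the unknot: `ρ = ‖x‖ ^ 2` has a single critical point,
the nondegenerate minimum at the origin. Gompf–Stipsicz (1999), §6.2. [cite: GompfStipsicz1999] -/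
theorem isRibbonDisc_unknot_flatDisc [SphereEmbedding.SmoothnessFacts] :
    unknot.IsRibbonDisc flatDisc := by
  refine ⟨isSliceDisc_unknot_flatDisc, ?_⟩
  simp only [norm_flatDisc]
  intro x _ hcrit
  have hx0 : x = 0 := by
    have := congrArg (fun φ ↦ φ x) hcrit
    simpa [fderiv_norm_sq_apply, real_inner_self_eq_norm_sq] using this
  subst hx0
  refine ⟨fun v hv ↦ ⟨v, ?_⟩, fun hmax ↦ ?_⟩
  · rw [iteratedFDeriv_two_apply, fderiv_norm_sq, ← FunLike.coe_smul,
      ContinuousLinearMap.fderiv]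
    have h2 : (2 • innerSL ℝ (E := 𝔼 2)) (![v, v] 0) (![v, v] 1) = 2 * ‖v‖ ^ 2 := by
      simp only [Matrix.cons_val_zero, Matrix.cons_val_one, smul_apply,
        innerSL_apply_apply (𝕜 := ℝ), real_inner_self_eq_norm_sq, nsmul_eq_mul, Nat.cast_ofNat]
    rw [h2]
    have : 0 < ‖v‖ := norm_pos_iff.mpr hv
    positivity
  · obtain ⟨ε, hε, hball⟩ := Metric.eventually_nhds_iff_ball.mp hmax
    have hy : ‖EuclideanSpace.single (0 : Fin 2) (ε / 2)‖ = ε / 2 := by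
      simp [hε.le]
    have := hball (EuclideanSpace.single (0 : Fin 2) (ε / 2))
      (by rw [mem_ball_zero_iff, hy]; exact half_lt_self hε)
    dsimp only at this
    rw [hy, norm_zero] at this
    nlinarith

/-- The unknot is ribbon (bounds the flat disc). Fox (1962); Gompf–Stipsicz (1999), §6.2. [cite: Fox1962] -/
theorem isRibbon_unknot [SphereEmbedding.SmoothnessFacts] : unknot.IsRibbon :=
  ⟨flatDisc, isRibbonDisc_unknot_flatDisc⟩

/-- The unknot is smoothly slice. Fox (1962), §7. [cite: Fox1962] -/
theorem isSmoothlySlice_unknot [SphereEmbedding.SmoothnessFacts] : unknot.IsSmoothlySlice :=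
  isRibbon_unknot.isSmoothlySlice

/-- The unknot is topologically slice. Relies on the named fact
`Knot.IsSmoothlySlice.isTopologicallySlice` (hypothesis `h`). Freedman–Quinn (1990), §9.3. [cite: FreedmanQuinn1990] -/
theorem isTopologicallySlice_unknot [SphereEmbedding.SmoothnessFacts]
    (h : Knot.IsSmoothlySlice.isTopologicallySlice) : unknot.IsTopologicallySlice :=
  h isSmoothlySlice_unknot

/-- Unknotted knots are smoothly slice. Relies on the named facts
`Knot.IsSmoothlySlice.of_isIsotopic` (hypothesis `hiso`) and symmetry of isotopy
(`[SphereEmbedding.IsotopyFacts 1 3]`). Fox (1962), §7. [cite: Fox1962] -/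
theorem Knot.IsUnknot.isSmoothlySlice [SphereEmbedding.SmoothnessFacts]
    [SphereEmbedding.IsotopyFacts 1 3] (hiso : Knot.IsSmoothlySlice.of_isIsotopic) {K : Knot}
    (h : K.IsUnknot) : K.IsSmoothlySlice :=
  hiso (SphereEmbedding.IsotopyFacts.symm h) isSmoothlySlice_unknot

end Literature.Topology.FourManifolds
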